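import Summits.CriticalPhenomena.CardyFormulaZ2.Theorems.CardyBoundaryCoulombGasBoundaryDefectGaussianRStubRealisabilityPart2
import Summits.CriticalPhenomena.CardyFormulaZ2.Theorems.CardyBoundaryCoulombGasBoundaryDefectGaussianRStubRealisabilityPart7
import Summits.CriticalPhenomena.CardyFormulaZ2.Theorems.CardyBoundaryCoulombGasBoundaryDefectGaussianRStubReferenceLimitPart1
import Summits.CriticalPhenomena.CardyFormulaZ2.Theorems.CardyBoundaryCoulombGasBoundaryDefectGaussianRStubTransportPathsPart9

/-!
# Stub `stub_realisability` of line `rainbow-monomials-in-excursion-kernels` — Part 42: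
# Lemma V — II: the generic reduction, and the local consequences of a `√8`-chart
# (crux `BoundaryDefectGaussianR`, stmt-CriticalPhenomena-14132)

* `tracked_unit_of_pcc`, `live_unit_of_tracked` — the generic reductions: validity
  (`CollarLegModel.IsValid`) settles every corner with a free cell, so unit differences at all
  tracked corners follow from the PRESCRIBED CORNER CONDITION (prescribed vertex-cell against
  prescribed face-cell); the four corners of a live edge are tracked corners.
* The geometric hypothesis under which Lemma V (Part 46) holds: every boundary vertex `x` of `V`
  (a vertex with a lattice neighbour outside `V`) has a **`√8`-chart** — on the lattice points `v`
  with `|v - x|² ≤ 8` (the `5 × 5` block), `V` agrees with a discrete half-plane `{0 ≤ (v - a)·d}`,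
  quadrant `{0 ≤ (v - a)·d ∧ 0 ≤ (v - a)·d⊥}` or three-quarter plane `{0 ≤ (v - a)·d ∨ 0 ≤ (v - a)·d⊥}`
  (`d` a unit vector, `d⊥ = (-d₂, d₁)`, `a ∈ ℤ²`). Lattice approximations of a rectilinear Jordan
  domain have such charts eventually (corners and edges of the polygon are many mesh widths apart;
  integer apices by rounding) — this is how the consumers discharge it. `chart_facts` (registered as
  `s13_chartFacts`) lists the fifteen consequences used downstream for an exterior dart `(x, k)`
  (`n = dir k`, `τ = dir (k+1)`): no width-one neck (`x - n ∈ V`), the faces away from the dart are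
  interior, no spike tip, no diagonal pinch, the second outer row is empty unless the wall turns back
  (and then the new wall runs straight for two steps), the outside of a convex corner is empty, no
  width-one notch. Proof: the membership of each of the sixteen lattice points involved is an affine
  condition in the two dot products `S = (x - a)·d`, `R = (x - a)·d⊥` and the pair
  `(n·d, n·d⊥) ∈ {(±1, 0), (0, ±1)}`; `omega` settles the three chart types. `chart_at` reads the
  facts with `dir`; `dsucc_turn` / `dsucc_back` are the rewriting rules of the boundary walk at
  convex / reflex corners (cf. `s3_dsucc_cases`).
-/

namespace Summit.CriticalPhenomena.CardyFormulaZ2.Cruxes.BoundaryDefectGaussianR.RainbowMonomialsInExcursionKernels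

open Literature.Probability.LatticeModels Literature.Probability.LatticeModels.CollarLegModel

/-- The four elements of `Fin 4` (file-local copy). [folklore] -/
private theorem fin4_cases (i : Fin 4) : i = 0 ∨ i = 1 ∨ i = 2 ∨ i = 3 := by fin_cases i <;> simp

/-- Every direction is `k + i` for some `i` (file-local copy). [folklore] -/
private theorem fin4_exists_add (k j : Fin 4) : ∃ i : Fin 4, j = k + i := ⟨j - k, by revert j k; decide⟩

/-! ### The generic part: validity settles every corner with a free cell -/

section Generic

variable (M : CollarLegModel)

/-- Live edges have both endpoints in `V`. [folklore] -/
theorem mem_E_iff {e : (ℤ × ℤ) × Bool} :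
    e ∈ M.E ↔ e ∈ SixVertex.edges M.V ∧ e.1 ∈ M.V ∧ SixVertex.edgeTip e ∈ M.V := by
  simp [CollarLegModel.E, inducedEdges]

/-- A vertex-cell that is not a free vertex is a Dirichlet arc vertex of `V` or a ghost. [folklore] -/
theorem mem_arc_or_ghosts_of_not_mem_freeCells {x : ℤ × ℤ} (hx : x ∈ M.vertexCells)
    (hfree : (x, false) ∉ M.freeCells) : (x ∈ M.V ∧ x ∈ M.C.arc) ∨ (x ∉ M.V ∧ x ∈ M.ghosts) := by
  rw [mem_freeCells_false] at hfree
  rcases Finset.mem_union.mp hx with hV | hg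
  · refine Or.inl ⟨hV, ?_⟩
    by_contra h
    exact hfree (Finset.mem_sdiff.mpr ⟨hV, h⟩)
  · exact Or.inr ⟨(Finset.mem_sdiff.mp hg).2, hg⟩

/-- A face-cell that is not a free face is neither an interior face nor a pocket. [folklore] -/
theorem not_mem_of_not_mem_freeCells {f : ℤ × ℤ} (hfree : (f, true) ∉ M.freeCells) :
    f ∉ interiorFaces M.V ∧ f ∉ M.pockets := by
  rw [mem_freeCells_true] at hfree
  exact ⟨fun h => hfree (Finset.mem_union_left _ h), fun h => hfree (Finset.mem_union_right _ h)⟩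

/-- **Generic reduction (tracked corners).** If the PRESCRIBED CORNER CONDITION holds — every
prescribed vertex-cell and every prescribed face-cell at it have heights differing by one — then
every valid configuration has unit height differences across every tracked corner (vertex-cell,
adjacent face-cell). [folklore] -/
theorem tracked_unit_of_pcc {h : ↥M.freeCells → ℤ} (hval : M.IsValid h)
    (hpcc : ∀ x ∈ M.vertexCells, (x, false) ∉ M.freeCells → ∀ f ∈ SixVertex.vertexFaces x,
      f ∈ M.faceCells → (f, true) ∉ M.freeCells → |M.C.vertH x - M.C.faceH f| = 1) :
    ∀ x ∈ M.vertexCells, ∀ f ∈ SixVertex.vertexFaces x, f ∈ M.faceCells → |M.hv h x - M.hf h f| = 1 := by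
  intro x hx f hf hfc
  by_cases hxf : (x, false) ∈ M.freeCells
  · exact hval x hx f hf hfc (Or.inl hxf)
  by_cases hff : (f, true) ∈ M.freeCells
  · exact hval x hx f hf hfc (Or.inr hff)
  rw [hv_of_not_mem M h hxf, hf_of_not_mem M h hff]
  exact hpcc x hx hxf f hf hfc hff

/-- **From tracked corners to live edges.** The four corners of a live edge are tracked corners. [folklore] -/
theorem live_unit_of_tracked {h : ↥M.freeCells → ℤ}
    (htr : ∀ x ∈ M.vertexCells, ∀ f ∈ SixVertex.vertexFaces x, f ∈ M.faceCells → |M.hv h x - M.hf h f| = 1) :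
    ∀ e ∈ M.E,
      |M.hv h e.1 - M.hf h (SixVertex.leftFace e false)| = 1 ∧
      |M.hv h e.1 - M.hf h (SixVertex.leftFace e true)| = 1 ∧
      |M.hv h (SixVertex.edgeTip e) - M.hf h (SixVertex.leftFace e false)| = 1 ∧
      |M.hv h (SixVertex.edgeTip e) - M.hf h (SixVertex.leftFace e true)| = 1 := by
  intro e he
  obtain ⟨-, h1, h2⟩ := (mem_E_iff M).mp he
  have c1 := fun b => mem_vertexFaces_of_mem_faceCorners (fst_mem_faceCorners_leftFace e b)
  have c2 := fun b => mem_vertexFaces_of_mem_faceCorners (tip_mem_faceCorners_leftFace e b)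
  have v1 : e.1 ∈ M.vertexCells := Finset.mem_union_left _ h1
  have v2 : SixVertex.edgeTip e ∈ M.vertexCells := Finset.mem_union_left _ h2
  exact ⟨htr _ v1 _ (c1 false) (M.mem_faceCells_of_mem_vertexFaces h1 (c1 false)),
    htr _ v1 _ (c1 true) (M.mem_faceCells_of_mem_vertexFaces h1 (c1 true)),
    htr _ v2 _ (c2 false) (M.mem_faceCells_of_mem_vertexFaces h2 (c2 false)),
    htr _ v2 _ (c2 true) (M.mem_faceCells_of_mem_vertexFaces h2 (c2 true))⟩

end Generic

/-! ### The four directions -/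

section Directions

/-- `dir (k + 1)` is `dir k` turned counter-clockwise. [folklore] -/
theorem dir_add_one (k : Fin 4) : dir (k + 1) = (-(dir k).2, (dir k).1) := by fin_cases k <;> decide

/-- The tip of a dart is `v + dir k`. [folklore] -/
theorem dartTip_mk (v : ℤ × ℤ) (k : Fin 4) : dartTip (v, k) = v + dir k := rfl

end Directions

section LocalChart

set_option maxHeartbeats 400000 in
/-- **Local consequences of a chart at a boundary vertex.** If `V` agrees, on the lattice points
within distance `√8` of `x ∈ V`, with a discrete half-plane, quadrant or three-quarter plane, and
`x + n ∉ V` for a unit vector `n` (write `τ = (-n₂, n₁)` for `n` turned counter-clockwise), then: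
`x - n ∈ V` (no width-one neck); `x ± τ ∈ V ⇒ x ± τ - n ∈ V` (the two faces at `x` away from `n`
are interior as soon as their near corner is in `V`); `x + τ` or `x - τ` is in `V` (no spike tip);
`x ± τ ∉ V ⇒ x + n ± τ ∉ V` (no diagonal pinch); `x + 2n ∉ V`, and `x + 2n ± τ ∉ V` unless the wall
turns back at `x + n ± τ` (a reflex corner), in which case the new wall is straight for two steps;
at a convex corner (`x + τ ∉ V`) the points `x + 2τ`, `x + n + 2τ`, `x + 2n + 2τ` are outside; and
`x + n ± τ` are not both in `V` (no width-one notch). [folklore] -/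
theorem chart_facts {V : Finset (ℤ × ℤ)} {x n : ℤ × ℤ}
    (hn : n = (1, 0) ∨ n = (-1, 0) ∨ n = (0, 1) ∨ n = (0, -1))
    (hx : x ∈ V) (hk : x + n ∉ V)
    (hC : ∃ a d : ℤ × ℤ, (d = (1, 0) ∨ d = (-1, 0) ∨ d = (0, 1) ∨ d = (0, -1)) ∧
      ((∀ v : ℤ × ℤ, (v.1 - x.1) ^ 2 + (v.2 - x.2) ^ 2 ≤ 8 →
          (v ∈ V ↔ 0 ≤ (v.1 - a.1) * d.1 + (v.2 - a.2) * d.2)) ∨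
       (∀ v : ℤ × ℤ, (v.1 - x.1) ^ 2 + (v.2 - x.2) ^ 2 ≤ 8 →
          (v ∈ V ↔ 0 ≤ (v.1 - a.1) * d.1 + (v.2 - a.2) * d.2 ∧ 0 ≤ (v.2 - a.2) * d.1 - (v.1 - a.1) * d.2)) ∨
       (∀ v : ℤ × ℤ, (v.1 - x.1) ^ 2 + (v.2 - x.2) ^ 2 ≤ 8 →
          (v ∈ V ↔ 0 ≤ (v.1 - a.1) * d.1 + (v.2 - a.2) * d.2 ∨ 0 ≤ (v.2 - a.2) * d.1 - (v.1 - a.1) * d.2)))) :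
    x - n ∈ V ∧
    (x + (-n.2, n.1) ∈ V → x + (-n.2, n.1) - n ∈ V) ∧
    (x - (-n.2, n.1) ∈ V → x - (-n.2, n.1) - n ∈ V) ∧
    (x + (-n.2, n.1) ∈ V ∨ x - (-n.2, n.1) ∈ V) ∧
    (x + (-n.2, n.1) ∉ V → x + n + (-n.2, n.1) ∉ V) ∧
    (x - (-n.2, n.1) ∉ V → x + n - (-n.2, n.1) ∉ V) ∧
    x + n + n ∉ V ∧
    (x + n + (-n.2, n.1) ∉ V → x + n + n + (-n.2, n.1) ∉ V) ∧
    (x + n - (-n.2, n.1) ∉ V → x + n + n - (-n.2, n.1) ∉ V) ∧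
    (x + (-n.2, n.1) ∉ V → x + n + n + (-n.2, n.1) + (-n.2, n.1) ∉ V) ∧
    (x + (-n.2, n.1) ∉ V → x + n + (-n.2, n.1) + (-n.2, n.1) ∉ V) ∧
    (x + (-n.2, n.1) ∉ V → x + (-n.2, n.1) + (-n.2, n.1) ∉ V) ∧
    ¬ (x + n + (-n.2, n.1) ∈ V ∧ x + n - (-n.2, n.1) ∈ V) ∧
    (x + n + (-n.2, n.1) ∈ V → x + n + n + (-n.2, n.1) ∈ V ∧ x + n + (-n.2, n.1) + (-n.2, n.1) ∈ V) ∧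
    (x + n - (-n.2, n.1) ∈ V → x + n + n - (-n.2, n.1) ∈ V ∧ x + n - (-n.2, n.1) - (-n.2, n.1) ∈ V) := by
  obtain ⟨x₁, x₂⟩ := x
  obtain ⟨n₁, n₂⟩ := n
  simp only [Prod.mk_add_mk, Prod.mk_sub_mk] at hk ⊢
  obtain ⟨⟨a₁, a₂⟩, ⟨d₁, d₂⟩, hd, hP⟩ := hC
  simp only [Prod.mk.injEq] at hd hn
  -- the two dot products `α = n·d`, `β = n·d⊥` of the unit vectors `n`, `d`
  have hαβ : (n₁ * d₁ + n₂ * d₂ = 1 ∧ n₂ * d₁ - n₁ * d₂ = 0) ∨ (n₁ * d₁ + n₂ * d₂ = -1 ∧ n₂ * d₁ - n₁ * d₂ = 0) ∨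
      (n₁ * d₁ + n₂ * d₂ = 0 ∧ n₂ * d₁ - n₁ * d₂ = 1) ∨ (n₁ * d₁ + n₂ * d₂ = 0 ∧ n₂ * d₁ - n₁ * d₂ = -1) := by
    rcases hn with ⟨rfl, rfl⟩ | ⟨rfl, rfl⟩ | ⟨rfl, rfl⟩ | ⟨rfl, rfl⟩ <;>
      rcases hd with ⟨rfl, rfl⟩ | ⟨rfl, rfl⟩ | ⟨rfl, rfl⟩ | ⟨rfl, rfl⟩ <;> simp
  have hsq : n₁ ^ 2 + n₂ ^ 2 = 1 ∧ n₁ * n₂ = 0 := by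
    rcases hn with ⟨rfl, rfl⟩ | ⟨rfl, rfl⟩ | ⟨rfl, rfl⟩ | ⟨rfl, rfl⟩ <;> simp
  -- distances of the sixteen points from `x`
  have q0 : (x₁ - x₁) ^ 2 + (x₂ - x₂) ^ 2 ≤ 8 := by nlinarith [hsq.1, hsq.2]
  have q1 : (x₁ + n₁ - x₁) ^ 2 + (x₂ + n₂ - x₂) ^ 2 ≤ 8 := by nlinarith [hsq.1, hsq.2]
  have q2 : (x₁ - n₁ - x₁) ^ 2 + (x₂ - n₂ - x₂) ^ 2 ≤ 8 := by nlinarith [hsq.1, hsq.2]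
  have q3 : (x₁ + -n₂ - x₁) ^ 2 + (x₂ + n₁ - x₂) ^ 2 ≤ 8 := by nlinarith [hsq.1, hsq.2]
  have q4 : (x₁ - -n₂ - x₁) ^ 2 + (x₂ - n₁ - x₂) ^ 2 ≤ 8 := by nlinarith [hsq.1, hsq.2]
  have q5 : (x₁ + -n₂ - n₁ - x₁) ^ 2 + (x₂ + n₁ - n₂ - x₂) ^ 2 ≤ 8 := by nlinarith [hsq.1, hsq.2]
  have q6 : (x₁ - -n₂ - n₁ - x₁) ^ 2 + (x₂ - n₁ - n₂ - x₂) ^ 2 ≤ 8 := by nlinarith [hsq.1, hsq.2]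
  have q7 : (x₁ + n₁ + -n₂ - x₁) ^ 2 + (x₂ + n₂ + n₁ - x₂) ^ 2 ≤ 8 := by nlinarith [hsq.1, hsq.2]
  have q8 : (x₁ + n₁ - -n₂ - x₁) ^ 2 + (x₂ + n₂ - n₁ - x₂) ^ 2 ≤ 8 := by nlinarith [hsq.1, hsq.2]
  have q9 : (x₁ + n₁ + n₁ - x₁) ^ 2 + (x₂ + n₂ + n₂ - x₂) ^ 2 ≤ 8 := by nlinarith [hsq.1, hsq.2]
  have q10 : (x₁ + n₁ + n₁ + -n₂ - x₁) ^ 2 + (x₂ + n₂ + n₂ + n₁ - x₂) ^ 2 ≤ 8 := by nlinarith [hsq.1, hsq.2]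
  have q11 : (x₁ + n₁ + n₁ - -n₂ - x₁) ^ 2 + (x₂ + n₂ + n₂ - n₁ - x₂) ^ 2 ≤ 8 := by nlinarith [hsq.1, hsq.2]
  have q12 : (x₁ + n₁ + n₁ + -n₂ + -n₂ - x₁) ^ 2 + (x₂ + n₂ + n₂ + n₁ + n₁ - x₂) ^ 2 ≤ 8 := by nlinarith [hsq.1, hsq.2]
  have q13 : (x₁ + n₁ + -n₂ + -n₂ - x₁) ^ 2 + (x₂ + n₂ + n₁ + n₁ - x₂) ^ 2 ≤ 8 := by nlinarith [hsq.1, hsq.2]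
  have q14 : (x₁ + -n₂ + -n₂ - x₁) ^ 2 + (x₂ + n₁ + n₁ - x₂) ^ 2 ≤ 8 := by nlinarith [hsq.1, hsq.2]
  have q15 : (x₁ + n₁ - -n₂ - -n₂ - x₁) ^ 2 + (x₂ + n₂ - n₁ - n₁ - x₂) ^ 2 ≤ 8 := by nlinarith [hsq.1, hsq.2]
  -- affine bookkeeping: `S(x + i n + j τ) = S(x) + i α - j β`, `R(x + i n + j τ) = R(x) + i β + j α`
  have s1 : (x₁ + n₁ - a₁) * d₁ + (x₂ + n₂ - a₂) * d₂ =
      ((x₁ - a₁) * d₁ + (x₂ - a₂) * d₂) + (n₁ * d₁ + n₂ * d₂) := by ring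
  have r1 : (x₂ + n₂ - a₂) * d₁ - (x₁ + n₁ - a₁) * d₂ =
      ((x₂ - a₂) * d₁ - (x₁ - a₁) * d₂) + (n₂ * d₁ - n₁ * d₂) := by ring
  have s2 : (x₁ - n₁ - a₁) * d₁ + (x₂ - n₂ - a₂) * d₂ =
      ((x₁ - a₁) * d₁ + (x₂ - a₂) * d₂) - (n₁ * d₁ + n₂ * d₂) := by ring
  have r2 : (x₂ - n₂ - a₂) * d₁ - (x₁ - n₁ - a₁) * d₂ =
      ((x₂ - a₂) * d₁ - (x₁ - a₁) * d₂) - (n₂ * d₁ - n₁ * d₂) := by ring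
  have s3 : (x₁ + -n₂ - a₁) * d₁ + (x₂ + n₁ - a₂) * d₂ =
      ((x₁ - a₁) * d₁ + (x₂ - a₂) * d₂) - (n₂ * d₁ - n₁ * d₂) := by ring
  have r3 : (x₂ + n₁ - a₂) * d₁ - (x₁ + -n₂ - a₁) * d₂ =
      ((x₂ - a₂) * d₁ - (x₁ - a₁) * d₂) + (n₁ * d₁ + n₂ * d₂) := by ring
  have s4 : (x₁ - -n₂ - a₁) * d₁ + (x₂ - n₁ - a₂) * d₂ =
      ((x₁ - a₁) * d₁ + (x₂ - a₂) * d₂) + (n₂ * d₁ - n₁ * d₂) := by ring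
  have r4 : (x₂ - n₁ - a₂) * d₁ - (x₁ - -n₂ - a₁) * d₂ =
      ((x₂ - a₂) * d₁ - (x₁ - a₁) * d₂) - (n₁ * d₁ + n₂ * d₂) := by ring
  have s5 : (x₁ + -n₂ - n₁ - a₁) * d₁ + (x₂ + n₁ - n₂ - a₂) * d₂ =
      ((x₁ - a₁) * d₁ + (x₂ - a₂) * d₂) - (n₁ * d₁ + n₂ * d₂) - (n₂ * d₁ - n₁ * d₂) := by ring
  have r5 : (x₂ + n₁ - n₂ - a₂) * d₁ - (x₁ + -n₂ - n₁ - a₁) * d₂ =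
      ((x₂ - a₂) * d₁ - (x₁ - a₁) * d₂) - (n₂ * d₁ - n₁ * d₂) + (n₁ * d₁ + n₂ * d₂) := by ring
  have s6 : (x₁ - -n₂ - n₁ - a₁) * d₁ + (x₂ - n₁ - n₂ - a₂) * d₂ =
      ((x₁ - a₁) * d₁ + (x₂ - a₂) * d₂) - (n₁ * d₁ + n₂ * d₂) + (n₂ * d₁ - n₁ * d₂) := by ring
  have r6 : (x₂ - n₁ - n₂ - a₂) * d₁ - (x₁ - -n₂ - n₁ - a₁) * d₂ =
      ((x₂ - a₂) * d₁ - (x₁ - a₁) * d₂) - (n₂ * d₁ - n₁ * d₂) - (n₁ * d₁ + n₂ * d₂) := by ring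
  have s7 : (x₁ + n₁ + -n₂ - a₁) * d₁ + (x₂ + n₂ + n₁ - a₂) * d₂ =
      ((x₁ - a₁) * d₁ + (x₂ - a₂) * d₂) + (n₁ * d₁ + n₂ * d₂) - (n₂ * d₁ - n₁ * d₂) := by ring
  have r7 : (x₂ + n₂ + n₁ - a₂) * d₁ - (x₁ + n₁ + -n₂ - a₁) * d₂ =
      ((x₂ - a₂) * d₁ - (x₁ - a₁) * d₂) + (n₂ * d₁ - n₁ * d₂) + (n₁ * d₁ + n₂ * d₂) := by ring
  have s8 : (x₁ + n₁ - -n₂ - a₁) * d₁ + (x₂ + n₂ - n₁ - a₂) * d₂ =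
      ((x₁ - a₁) * d₁ + (x₂ - a₂) * d₂) + (n₁ * d₁ + n₂ * d₂) + (n₂ * d₁ - n₁ * d₂) := by ring
  have r8 : (x₂ + n₂ - n₁ - a₂) * d₁ - (x₁ + n₁ - -n₂ - a₁) * d₂ =
      ((x₂ - a₂) * d₁ - (x₁ - a₁) * d₂) + (n₂ * d₁ - n₁ * d₂) - (n₁ * d₁ + n₂ * d₂) := by ring
  have s9 : (x₁ + n₁ + n₁ - a₁) * d₁ + (x₂ + n₂ + n₂ - a₂) * d₂ =
      ((x₁ - a₁) * d₁ + (x₂ - a₂) * d₂) + 2 * (n₁ * d₁ + n₂ * d₂) := by ring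
  have r9 : (x₂ + n₂ + n₂ - a₂) * d₁ - (x₁ + n₁ + n₁ - a₁) * d₂ =
      ((x₂ - a₂) * d₁ - (x₁ - a₁) * d₂) + 2 * (n₂ * d₁ - n₁ * d₂) := by ring
  have s10 : (x₁ + n₁ + n₁ + -n₂ - a₁) * d₁ + (x₂ + n₂ + n₂ + n₁ - a₂) * d₂ =
      ((x₁ - a₁) * d₁ + (x₂ - a₂) * d₂) + 2 * (n₁ * d₁ + n₂ * d₂) - (n₂ * d₁ - n₁ * d₂) := by ring
  have r10 : (x₂ + n₂ + n₂ + n₁ - a₂) * d₁ - (x₁ + n₁ + n₁ + -n₂ - a₁) * d₂ =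
      ((x₂ - a₂) * d₁ - (x₁ - a₁) * d₂) + 2 * (n₂ * d₁ - n₁ * d₂) + (n₁ * d₁ + n₂ * d₂) := by ring
  have s11 : (x₁ + n₁ + n₁ - -n₂ - a₁) * d₁ + (x₂ + n₂ + n₂ - n₁ - a₂) * d₂ =
      ((x₁ - a₁) * d₁ + (x₂ - a₂) * d₂) + 2 * (n₁ * d₁ + n₂ * d₂) + (n₂ * d₁ - n₁ * d₂) := by ring
  have r11 : (x₂ + n₂ + n₂ - n₁ - a₂) * d₁ - (x₁ + n₁ + n₁ - -n₂ - a₁) * d₂ =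
      ((x₂ - a₂) * d₁ - (x₁ - a₁) * d₂) + 2 * (n₂ * d₁ - n₁ * d₂) - (n₁ * d₁ + n₂ * d₂) := by ring
  have s12 : (x₁ + n₁ + n₁ + -n₂ + -n₂ - a₁) * d₁ + (x₂ + n₂ + n₂ + n₁ + n₁ - a₂) * d₂ =
      ((x₁ - a₁) * d₁ + (x₂ - a₂) * d₂) + 2 * (n₁ * d₁ + n₂ * d₂) - 2 * (n₂ * d₁ - n₁ * d₂) := by ring
  have r12 : (x₂ + n₂ + n₂ + n₁ + n₁ - a₂) * d₁ - (x₁ + n₁ + n₁ + -n₂ + -n₂ - a₁) * d₂ =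
      ((x₂ - a₂) * d₁ - (x₁ - a₁) * d₂) + 2 * (n₂ * d₁ - n₁ * d₂) + 2 * (n₁ * d₁ + n₂ * d₂) := by ring
  have s13 : (x₁ + n₁ + -n₂ + -n₂ - a₁) * d₁ + (x₂ + n₂ + n₁ + n₁ - a₂) * d₂ =
      ((x₁ - a₁) * d₁ + (x₂ - a₂) * d₂) + (n₁ * d₁ + n₂ * d₂) - 2 * (n₂ * d₁ - n₁ * d₂) := by ring
  have r13 : (x₂ + n₂ + n₁ + n₁ - a₂) * d₁ - (x₁ + n₁ + -n₂ + -n₂ - a₁) * d₂ =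
      ((x₂ - a₂) * d₁ - (x₁ - a₁) * d₂) + (n₂ * d₁ - n₁ * d₂) + 2 * (n₁ * d₁ + n₂ * d₂) := by ring
  have s14 : (x₁ + -n₂ + -n₂ - a₁) * d₁ + (x₂ + n₁ + n₁ - a₂) * d₂ =
      ((x₁ - a₁) * d₁ + (x₂ - a₂) * d₂) - 2 * (n₂ * d₁ - n₁ * d₂) := by ring
  have r14 : (x₂ + n₁ + n₁ - a₂) * d₁ - (x₁ + -n₂ + -n₂ - a₁) * d₂ =
      ((x₂ - a₂) * d₁ - (x₁ - a₁) * d₂) + 2 * (n₁ * d₁ + n₂ * d₂) := by ring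
  have s15 : (x₁ + n₁ - -n₂ - -n₂ - a₁) * d₁ + (x₂ + n₂ - n₁ - n₁ - a₂) * d₂ =
      ((x₁ - a₁) * d₁ + (x₂ - a₂) * d₂) + (n₁ * d₁ + n₂ * d₂) + 2 * (n₂ * d₁ - n₁ * d₂) := by ring
  have r15 : (x₂ + n₂ - n₁ - n₁ - a₂) * d₁ - (x₁ + n₁ - -n₂ - -n₂ - a₁) * d₂ =
      ((x₂ - a₂) * d₁ - (x₁ - a₁) * d₂) + (n₂ * d₁ - n₁ * d₂) - 2 * (n₁ * d₁ + n₂ * d₂) := by ring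
  rcases hP with hP | hP | hP
  all_goals
    have m0 := hP (x₁, x₂) q0
    have m1 := hP (x₁ + n₁, x₂ + n₂) q1
    have m2 := hP (x₁ - n₁, x₂ - n₂) q2
    have m3 := hP (x₁ + -n₂, x₂ + n₁) q3
    have m4 := hP (x₁ - -n₂, x₂ - n₁) q4
    have m5 := hP (x₁ + -n₂ - n₁, x₂ + n₁ - n₂) q5
    have m6 := hP (x₁ - -n₂ - n₁, x₂ - n₁ - n₂) q6
    have m7 := hP (x₁ + n₁ + -n₂, x₂ + n₂ + n₁) q7
    have m8 := hP (x₁ + n₁ - -n₂, x₂ + n₂ - n₁) q8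
    have m9 := hP (x₁ + n₁ + n₁, x₂ + n₂ + n₂) q9
    have m10 := hP (x₁ + n₁ + n₁ + -n₂, x₂ + n₂ + n₂ + n₁) q10
    have m11 := hP (x₁ + n₁ + n₁ - -n₂, x₂ + n₂ + n₂ - n₁) q11
    have m12 := hP (x₁ + n₁ + n₁ + -n₂ + -n₂, x₂ + n₂ + n₂ + n₁ + n₁) q12
    have m13 := hP (x₁ + n₁ + -n₂ + -n₂, x₂ + n₂ + n₁ + n₁) q13
    have m14 := hP (x₁ + -n₂ + -n₂, x₂ + n₁ + n₁) q14
    have m15 := hP (x₁ + n₁ - -n₂ - -n₂, x₂ + n₂ - n₁ - n₁) q15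
    clear hP
    dsimp only at m0 m1 m2 m3 m4 m5 m6 m7 m8 m9 m10 m11 m12 m13 m14 m15
    simp only [s1, r1, s2, r2, s3, r3, s4, r4, s5, r5, s6, r6, s7, r7, s8, r8, s9, r9, s10, r10, s11, r11, s12, r12, s13, r13, s14, r14, s15, r15] at m1 m2 m3 m4 m5 m6 m7 m8 m9 m10 m11 m12 m13 m14 m15
    rw [m0] at hx
    rw [m1] at hk
    simp only [m2, m3, m4, m5, m6, m7, m8, m9, m10, m11, m12, m13, m14, m15]
    clear m0 m1 m2 m3 m4 m5 m6 m7 m8 m9 m10 m11 m12 m13 m14 m15 s1 r1 s2 r2 s3 r3 s4 r4 s5 r5 s6 r6 s7 r7 s8 r8 s9 r9 s10 r10 s11 r11 s12 r12 s13 r13 s14 r14 s15 r15 q0 q1 q2 q3 q4 q5 q6 q7 q8 q9 q10 q11 q12 q13 q14 q15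
    generalize (x₁ - a₁) * d₁ + (x₂ - a₂) * d₂ = S at *
    generalize (x₂ - a₂) * d₁ - (x₁ - a₁) * d₂ = R at *
    generalize n₁ * d₁ + n₂ * d₂ = α at *
    generalize n₂ * d₁ - n₁ * d₂ = β at *
    omega


/-- **The chart facts at an exterior dart**, read with `n = dir k`, `τ = dir (k + 1)`, from the
hypothesis that every boundary vertex of `V` has a `√8`-chart. [folklore] -/
theorem chart_at {V : Finset (ℤ × ℤ)}
    (hCH : ∀ x ∈ V, (∃ y : ℤ × ℤ, y ∉ V ∧ (y.1 - x.1) ^ 2 + (y.2 - x.2) ^ 2 = 1) →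
      ∃ a d : ℤ × ℤ, (d = (1, 0) ∨ d = (-1, 0) ∨ d = (0, 1) ∨ d = (0, -1)) ∧
      ((∀ v : ℤ × ℤ, (v.1 - x.1) ^ 2 + (v.2 - x.2) ^ 2 ≤ 8 →
          (v ∈ V ↔ 0 ≤ (v.1 - a.1) * d.1 + (v.2 - a.2) * d.2)) ∨
       (∀ v : ℤ × ℤ, (v.1 - x.1) ^ 2 + (v.2 - x.2) ^ 2 ≤ 8 →
          (v ∈ V ↔ 0 ≤ (v.1 - a.1) * d.1 + (v.2 - a.2) * d.2 ∧ 0 ≤ (v.2 - a.2) * d.1 - (v.1 - a.1) * d.2)) ∨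
       (∀ v : ℤ × ℤ, (v.1 - x.1) ^ 2 + (v.2 - x.2) ^ 2 ≤ 8 →
          (v ∈ V ↔ 0 ≤ (v.1 - a.1) * d.1 + (v.2 - a.2) * d.2 ∨ 0 ≤ (v.2 - a.2) * d.1 - (v.1 - a.1) * d.2))))
    {x : ℤ × ℤ} {k : Fin 4} (hx : x ∈ V) (hk : x + dir k ∉ V) :
    x - dir k ∈ V ∧
    (x + dir (k + 1) ∈ V → x + dir (k + 1) - dir k ∈ V) ∧
    (x - dir (k + 1) ∈ V → x - dir (k + 1) - dir k ∈ V) ∧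
    (x + dir (k + 1) ∈ V ∨ x - dir (k + 1) ∈ V) ∧
    (x + dir (k + 1) ∉ V → x + dir k + dir (k + 1) ∉ V) ∧
    (x - dir (k + 1) ∉ V → x + dir k - dir (k + 1) ∉ V) ∧
    x + dir k + dir k ∉ V ∧
    (x + dir k + dir (k + 1) ∉ V → x + dir k + dir k + dir (k + 1) ∉ V) ∧
    (x + dir k - dir (k + 1) ∉ V → x + dir k + dir k - dir (k + 1) ∉ V) ∧
    (x + dir (k + 1) ∉ V → x + dir k + dir k + dir (k + 1) + dir (k + 1) ∉ V) ∧
    (x + dir (k + 1) ∉ V → x + dir k + dir (k + 1) + dir (k + 1) ∉ V) ∧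
    (x + dir (k + 1) ∉ V → x + dir (k + 1) + dir (k + 1) ∉ V) ∧
    ¬ (x + dir k + dir (k + 1) ∈ V ∧ x + dir k - dir (k + 1) ∈ V) ∧
    (x + dir k + dir (k + 1) ∈ V → x + dir k + dir k + dir (k + 1) ∈ V ∧ x + dir k + dir (k + 1) + dir (k + 1) ∈ V) ∧
    (x + dir k - dir (k + 1) ∈ V → x + dir k + dir k - dir (k + 1) ∈ V ∧ x + dir k - dir (k + 1) - dir (k + 1) ∈ V) := by
  have hy : ∃ y : ℤ × ℤ, y ∉ V ∧ (y.1 - x.1) ^ 2 + (y.2 - x.2) ^ 2 = 1 :=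
    ⟨x + dir k, hk, by rcases fin4_cases k with rfl | rfl | rfl | rfl <;> simp⟩
  have h := chart_facts (by rcases fin4_cases k with rfl | rfl | rfl | rfl <;> simp) hx hk (hCH x hx hy)
  rwa [← dir_add_one] at h

/-- Turning at a convex corner: the rewriting rule for `dsucc`. [folklore] -/
theorem dsucc_turn {V : Finset (ℤ × ℤ)} {v : ℤ × ℤ} {k : Fin 4} (h1 : v + dir (k + 1) ∉ V) :
    dsucc V (v, k) = (v, k + 1) := by
  simp [dsucc, h1]

/-- Turning back at a reflex corner: the rewriting rule for `dsucc`. [folklore] -/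
theorem dsucc_back {V : Finset (ℤ × ℤ)} {v : ℤ × ℤ} {k : Fin 4} (h1 : v + dir (k + 1) ∈ V) (h2 : v + dir (k + 1) + dir k ∈ V) :
    dsucc V (v, k) = (v + dir (k + 1) + dir k, k + 3) := by
  simp [dsucc, h1, h2]

end LocalChart

/-! ### Registered one-line form -/

/-- **Sub-goal `s13_chartFacts`** (registered on stmt-CriticalPhenomena-14132): the fifteen local
consequences of a `√8`-chart at a boundary vertex `x ∈ V` with `x + n ∉ V` (`n` a unit vector,
`τ = (-n₂, n₁)`). [folklore] -/
theorem s13_chartFacts : ∀ (V : Finset (ℤ × ℤ)) (x n : ℤ × ℤ), (n = (1, 0) ∨ n = (-1, 0) ∨ n = (0, 1) ∨ n = (0, -1)) → x ∈ V → x + n ∉ V → (∃ a d : ℤ × ℤ, (d = (1, 0) ∨ d = (-1, 0) ∨ d = (0, 1) ∨ d = (0, -1)) ∧ ((∀ v : ℤ × ℤ, (v.1 - x.1) ^ 2 + (v.2 - x.2) ^ 2 ≤ 8 → (v ∈ V ↔ 0 ≤ (v.1 - a.1) * d.1 + (v.2 - a.2) * d.2)) ∨ (∀ v : ℤ × ℤ,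 (v.1 - x.1) ^ 2 + (v.2 - x.2) ^ 2 ≤ 8 → (v ∈ V ↔ 0 ≤ (v.1 - a.1) * d.1 + (v.2 - a.2) * d.2 ∧ 0 ≤ (v.2 - a.2) * d.1 - (v.1 - a.1) * d.2)) ∨ (∀ v : ℤ × ℤ, (v.1 - x.1) ^ 2 + (v.2 - x.2) ^ 2 ≤ 8 → (v ∈ V ↔ 0 ≤ (v.1 - a.1) * d.1 + (v.2 - a.2) * d.2 ∨ 0 ≤ (v.2 - a.2) * d.1 - (v.1 - a.1) * d.2)))) → x - n ∈ V ∧ (x + (-n.2, n.1) ∈ V → x + (-n.2, n.1) - n ∈ V) ∧ (x - (-n.2, n.1) ∈ V → x - (-n.2, n.1) - n ∈ V) ∧ (x + (-n.2, n.1) ∈ V ∨ x - (-n.2, n.1) ∈ V) ∧ (x + (-n.2, n.1) ∉ V → x + n + (-n.2, n.1) ∉ V) ∧ (x - (-n.2, n.1) ∉ V → x + n - (-n.2, n.1) ∉ V) ∧ x + n + n ∉ V ∧ (x + n + (-n.2, n.1) ∉ V → x + n + n + (-n.2, n.1) ∉ V) ∧ (x + n - (-n.2, n.1) ∉ V → x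 + n + n - (-n.2, n.1) ∉ V) ∧ (x + (-n.2, n.1) ∉ V → x + n + n + (-n.2, n.1) + (-n.2, n.1) ∉ V) ∧ (x + (-n.2, n.1) ∉ V → x + n + (-n.2, n.1) + (-n.2, n.1) ∉ V) ∧ (x + (-n.2, n.1) ∉ V → x + (-n.2, n.1) + (-n.2, n.1) ∉ V) ∧ ¬ (x + n + (-n.2, n.1) ∈ V ∧ x + n - (-n.2, n.1) ∈ V) ∧ (x + n + (-n.2, n.1) ∈ V → x + n + n + (-n.2, n.1) ∈ V ∧ x + n + (-n.2, n.1) + (-n.2, n.1) ∈ V) ∧ (x + n - (-n.2, n.1) ∈ V → x + n + n - (-n.2, n.1) ∈ V ∧ x + n - (-n.2, n.1) - (-n.2, n.1) ∈ V) :=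
  fun _ _ _ hn hx hk hC => chart_facts hn hx hk hC

end Summit.CriticalPhenomena.CardyFormulaZ2.Cruxes.BoundaryDefectGaussianR.RainbowMonomialsInExcursionKernels
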